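import Literature.AnabelianGeometry.EtaleTheta.Discharge.Sec5Thm56SubdagProofsGalois
import Literature.AnabelianGeometry.EtaleTheta.Discharge.Sec5Prop55RoofIndependentOfLaws
import Literature.AnabelianGeometry.EtaleTheta.Discharge.Sec5Thm56OfRoofs
import HarnessLib

/-!
# [EtTh] Prop. 5.5 / Thm. 5.6 (i) from the LAWS and from print's ROOFS `S″ → S`, `S″ → B_N` — the generic chain heads
# ON THE v2 SUBQUOTIENT RECORD `ThetaSubquotientProjGalois` (surjective at Galois objects only; proof-only)

S. Mochizuki, *The étale theta function and its Frobenioid-theoretic manifestations*, Publ. RIMS **45** (2009) [MochizukiEtTh2009],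
Prop. 5.5 pp.327–328 (PDF pp.101–102), proof p.328 l.2–11 («we may transport this isomorphism from `S′` to an arbitrary
`(l, N)`-theta-saturated `S ∈ Ob(C)` by means of linear morphisms `S″ → S`, `S″ → S′` … which induce isomorphisms … independent of the
choice of `S″` … precisely because of the original "functoriality" of the isomorphism for `S′`»); Thm. 5.6 (i) pp.328–329 (PDF
pp.102–103), proof p.329 l.17–27 [cite: MochizukiEtTh2009, Prop 5.5 p.327 (PDF p.101)] [cite: MochizukiEtTh2009, Thm 5.6 p.328 (PDF p.102)].

abc-iut cell, layer L2, seat abc-iut-w5-d013 (gen 7); cone nodes EtTh:Prop5.5 / EtTh:Thm5.6(i); row «(w4-R) V1→V2 PORT OF THE PROP 5.5 /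
THM 5.6 (i) ROOF CHAIN BY ITS AUTHOR» (sequel of abc-iut-w6-d079's «PROJ-SURJ-PLAN-A» / (w4), GAP-LEDGER G-w4d042g3-1 plan (a)).
PROOF-ONLY (0 definitions; nothing landed is edited or restated).  WHY: abc-iut-L2-t4's v1 record `(P : ThetaSubquotientProj 𝔉)` asks
`proj E` to be onto at EVERY base object and is EMPTY at the root-model stub for `l` odd (p476337), so the generic chain heads of the
«laws» route (abc-iut-w4-d008 `Sec5Prop55OfLaws`: `autFunctorial_sgpCap_of_kummerShape`, `kummerShape_of_thetaPair`,
`transportIndependent_of_thetaPair`, `cyclotomicRigidity_of_laws`) and of the «roofs» route (this lineage's `Sec5Prop55OfRoofs`,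
`Sec5Prop55RoofIndependentOfLaws`, `Sec5Thm56OfRoofs`: `cyclotomicRigidity_unique_of_roofs`, `cyclotomicRigidity_of_roofs`,
`cyclotomicRigidity_of_sub_roofs`, `cyclotomicRigidity_of_laws_roofs`, `Thm56Sub.cyclotomicRigidityPreserved_of_sub_roofs`) quantify over
nothing there.  Here the SAME proofs are re-run VERBATIM on abc-iut-w6-d079's v2 record `(P : ThetaSubquotientProjGalois 𝔉 Gal)` (p481123;
INHABITED at every `ofSetting` carrier p481568 and at every level stub p486065), reading the `P`-typed inputs through their v2 twins
(`EtaTautologicalGal`, `UnitsCentralUnderLDeltaGal`, `CyclotomeCentralUnderLDeltaGal`, `DeltaTransportCompatGal`, `LDeltaCoveredGal`,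
`ThetaSubquotientProjGalois.IsKummerDetermined` / `.CyclotomicRigidity`, p484491) and consuming the v2 generic layer of p485216
(`rigidityFamily_eq_on_BN_of_isKummerDetermined_galois`, `cyclotomicRigidity_of_sub_galois`, `transportAtBN_of_galois`) and every `P`-free
producer (`transportIndependent_of`, `lDeltaModNMap_injective_of_reach`, `rigidityFamily_exists_of_roofs`, `rigidityFamily_exists_of_laws_roofs`,
`rigidityFamily_unique_of_roof`, `cyclotomicRigidityPreserved_of_roofs`) BY NAME.  The v1 theorems are the `P.toGalois` instances of these.

* `autFunctorial_sgpCap_of_kummerShape_galois`, `kummerShape_of_thetaPair_galois`, `transportIndependent_of_thetaPair_galois`,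
  **`cyclotomicRigidity_of_laws_galois`** (Prop. 5.5 from the laws, fixed source);
* `cyclotomicRigidity_unique_of_roofs_galois`, `cyclotomicRigidity_of_roofs_galois`, **`cyclotomicRigidity_of_sub_roofs_galois`**,
  **`cyclotomicRigidity_of_laws_roofs_galois`** (Prop. 5.5 from print's roofs);
* **`Thm56Sub.cyclotomicRigidityPreserved_of_sub_roofs_galois`** (Thm. 5.6 (i), abc-iut-L2-t4's `P`-free conclusion
  `CyclotomicRigidityPreserved Ψ ρ aΨ`, roof form, `hBN` DERIVED by `transportAtBN_of_galois`).

HONEST FRAMING: kernel-checked implications between the cell's typed statements about the abstract §5 data; the structural laws, the roofs,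
the pin and the transports are HYPOTHESES (what the genuine instance supplies), not asserted; nothing asserts that such data exist for an
actual curve; [EtTh] is refereed pre-IUT material; nothing here bears on [IUTchIII] Cor. 3.12 — no side is taken; typed ≠ proved.
-/

namespace Literature.AnabelianGeometry.EtaleTheta

open CategoryTheory
open FrobenioidCyclotomicRigidity
open Literature.AlgebraicGeometry.Frobenioids

universe w v v' u u'

namespace ThetaFrobenioid

namespace Thm56Sub

variable {C : Type u} [Category.{v} C] {D : Type u'} [Category.{v'} D] {𝔉 : ThetaFrobenioid.{w} C D} {Gal : D → Prop}

/-! ### The «laws» route (abc-iut-w4-d008's `Sec5Prop55OfLaws`) on the v2 record -/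

/-- (v2 record; abc-iut-w4-d008's `autFunctorial_sgpCap_of_kummerShape` VERBATIM.) **Functoriality (F) of `ρ₀` along the lifts
`s^⊓-gp_N(g)`, `g ∈ Aut_D(B_N^bs)`, DERIVED from the Kummer-determined shape** «`ρ₀([proj h]) = s^⊓-gp_N(h) · s^⊔-gp_N(h)⁻¹`» (Prop. 5.2
(iii)), given T56-L09d `hspec`, (S) `hsec`, coverage `hcov` (v2 `LDeltaCoveredGal`), and the structural laws `hproj` (transport of structure
on the theta subquotient, p.327 (PDF p.101) «these subquotients determine subquotients `Aut_D(D) ↠ Aut^Θ_D(D)`») and `hcup` (conjugation-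
equivariance of `s^⊔-gp_N` through `s^⊓-gp_N` over `(l·Δ_Θ)`, p.329 (PDF p.103) l.17–21).  [cite: MochizukiEtTh2009, Prop 5.5 proof p.328 (PDF p.102)] -/
theorem autFunctorial_sgpCap_of_kummerShape_galois (hspec : UnitsPullSpec 𝔉) (hsec : 𝔉.SgpCapSection)
    (P : ThetaSubquotientProjGalois 𝔉 Gal) (hcov : LDeltaCoveredGal 𝔉 P)
    (ρ₀ : 𝔉.lDeltaModN 𝔉.BN ≃* 𝔉.muTorsion 𝔉.BN 𝔉.N)
    (hKD : ∀ (h : 𝔉.HB) (hh : (h : Aut (𝔉.base.obj 𝔉.BN)) ∈ P.pre (𝔉.base.obj 𝔉.BN)),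
      (ρ₀ (QuotientGroup.mk (P.proj _ ⟨h, hh⟩)) : Aut 𝔉.BN) =
        𝔉.sgpCap (h : Aut (𝔉.base.obj 𝔉.BN)) * (𝔉.sgpCup h)⁻¹)
    (hproj : ∀ (g h : Aut (𝔉.base.obj 𝔉.BN)) (hh : h ∈ P.pre (𝔉.base.obj 𝔉.BN)),
      ∃ hgh : g * h * g⁻¹ ∈ P.pre (𝔉.base.obj 𝔉.BN),
        𝔉.lDeltaMap g.hom (P.proj _ ⟨h, hh⟩) = P.proj _ ⟨g * h * g⁻¹, hgh⟩)
    (hcup : ∀ (g : Aut (𝔉.base.obj 𝔉.BN)) (h : 𝔉.HB),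
      (h : Aut (𝔉.base.obj 𝔉.BN)) ∈ P.pre (𝔉.base.obj 𝔉.BN) →
        ∃ hmem : g * (h : Aut (𝔉.base.obj 𝔉.BN)) * g⁻¹ ∈ 𝔉.HB,
          𝔉.sgpCup ⟨g * (h : Aut (𝔉.base.obj 𝔉.BN)) * g⁻¹, hmem⟩ =
            𝔉.sgpCap g * 𝔉.sgpCup h * (𝔉.sgpCap g)⁻¹)
    (g : Aut (𝔉.base.obj 𝔉.BN)) (x : 𝔉.lDeltaModN 𝔉.BN) :
    𝔉.muTorsionPull (𝔉.sgpCap g).hom 𝔉.N (ρ₀ (𝔉.lDeltaModNMap (𝔉.sgpCap g).hom x)) = ρ₀ x := by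
  obtain ⟨h, hh, rfl⟩ := hcov x
  obtain ⟨hgh, hprojEq⟩ := hproj g h hh
  obtain ⟨hmem, hcupEq⟩ := hcup g h hh
  -- the `Δ`-side: `Δ-push(s^⊓-gp_N(g)) [proj h] = [proj (g h g⁻¹)]`
  have hΔ : 𝔉.lDeltaModNMap (𝔉.sgpCap g).hom (QuotientGroup.mk (P.proj _ ⟨h, hh⟩)) =
      QuotientGroup.mk (P.proj _ ⟨((⟨g * (h : Aut (𝔉.base.obj 𝔉.BN)) * g⁻¹, hmem⟩ : 𝔉.HB) :
        Aut (𝔉.base.obj 𝔉.BN)), hgh⟩) := by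
    change QuotientGroup.mk (𝔉.lDeltaMap (𝔉.base.map (𝔉.sgpCap g).hom) (P.proj _ ⟨h, hh⟩)) = _
    have hαb : 𝔉.base.map (𝔉.sgpCap g).hom = g.hom := congrArg Iso.hom (hsec g)
    rw [hαb, hprojEq]
  rw [hΔ]
  apply Subtype.ext
  rw [coe_muTorsionPull_aut hspec, hKD _ hgh, hKD h hh]
  change (𝔉.sgpCap g)⁻¹ * (𝔉.sgpCap (g * (h : Aut (𝔉.base.obj 𝔉.BN)) * g⁻¹) *
      (𝔉.sgpCup ⟨g * (h : Aut (𝔉.base.obj 𝔉.BN)) * g⁻¹, hmem⟩)⁻¹) * 𝔉.sgpCap g =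
    𝔉.sgpCap (h : Aut (𝔉.base.obj 𝔉.BN)) * (𝔉.sgpCup h)⁻¹
  rw [hcupEq, map_mul, map_mul, map_inv]
  group

/-- (v2 record; abc-iut-w4-d008's `kummerShape_of_thetaPair` VERBATIM.) The Kummer-determined SHAPE of `ν` on the part over
`(l·Δ_Θ)_{B_N}` from the Prop. 5.2 (iii) pin (`ThetaPairKummerClass η ν`), tautological `η` (P55-L02, v2 `EtaTautologicalGal`) and
centrality (P55-L02b, v2 `CyclotomeCentralUnderLDeltaGal`), for the bare isomorphism `ν`.  [cite: MochizukiEtTh2009, Prop 5.5 p.327 (PDF p.101)] -/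
theorem kummerShape_of_thetaPair_galois (P : ThetaSubquotientProjGalois 𝔉 Gal) {η : 𝔉.HB → 𝔉.lDeltaModN 𝔉.BN}
    {ν : 𝔉.lDeltaModN 𝔉.BN ≃* 𝔉.muTorsion 𝔉.BN 𝔉.N}
    (hK : FrobenioidThetaBiKummer.ThetaPairKummerClass 𝔉 η ν) (hη : EtaTautologicalGal 𝔉 P η)
    (hc : CyclotomeCentralUnderLDeltaGal 𝔉 P) (h : 𝔉.HB)
    (hh : (h : Aut (𝔉.base.obj 𝔉.BN)) ∈ P.pre (𝔉.base.obj 𝔉.BN)) :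
    (ν (QuotientGroup.mk (P.proj _ ⟨h, hh⟩)) : Aut 𝔉.BN) =
      𝔉.sgpCap (h : Aut (𝔉.base.obj 𝔉.BN)) * (𝔉.sgpCup h)⁻¹ := by
  obtain ⟨u, hu, hall⟩ := hK
  have hcomm : 𝔉.sgpCap (h : Aut (𝔉.base.obj 𝔉.BN)) * u = u * 𝔉.sgpCap (h : Aut (𝔉.base.obj 𝔉.BN)) :=
    hc _ hh u hu
  have hcob : 𝔉.sgpCap (h : Aut (𝔉.base.obj 𝔉.BN)) * u * (𝔉.sgpCap (h : Aut (𝔉.base.obj 𝔉.BN)))⁻¹ * u⁻¹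
      = 1 := by
    rw [hcomm, mul_inv_cancel_right, mul_inv_cancel]
  rw [hall h, hcob, one_mul, hη h hh]

/-- (v2 record; abc-iut-w4-d008's `transportIndependent_of_thetaPair` VERBATIM.) **P55-L06 from structural laws only** —
`TransportIndependent ν` (a `P`-free statement) for the isomorphism `ν` pinned by the second Kummer class (Prop. 5.2 (iii)): the inputs
of `transportIndependent_of` with (F) DISCHARGED by `autFunctorial_sgpCap_of_kummerShape_galois` + `kummerShape_of_thetaPair_galois` and
(I) by `lDeltaModNMap_injective_of_reach`.  [cite: MochizukiEtTh2009, Prop 5.5 proof p.328 (PDF p.102)] -/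
theorem transportIndependent_of_thetaPair_galois (P : ThetaSubquotientProjGalois 𝔉 Gal) {η : 𝔉.HB → 𝔉.lDeltaModN 𝔉.BN}
    {ν : 𝔉.lDeltaModN 𝔉.BN ≃* 𝔉.muTorsion 𝔉.BN 𝔉.N}
    (hK : FrobenioidThetaBiKummer.ThetaPairKummerClass 𝔉 η ν) (hη : EtaTautologicalGal 𝔉 P η)
    (hc : CyclotomeCentralUnderLDeltaGal 𝔉 P) (hreach : BijectivelyReachableFromBN 𝔉)
    (hUc : UnitsPullComp 𝔉) (hLc : LDeltaMapComp 𝔉) (hLi : LDeltaMapId 𝔉) (hspec : UnitsPullSpec 𝔉)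
    (hcov : LDeltaCoveredGal 𝔉 P)
    (hgal : ∀ (T : C), 𝔉.IsThetaSaturated T → ∀ (φ φ' : 𝔉.BN ⟶ T), 𝔉.IsLinear φ → 𝔉.IsLinear φ' →
      ∃ g : Aut (𝔉.base.obj 𝔉.BN), 𝔉.base.map φ' = g.hom ≫ 𝔉.base.map φ)
    (hsec : 𝔉.SgpCapSection)
    (hUb : ∀ {S T : C} (φ ψ : S ⟶ T), 𝔉.IsLinear φ → 𝔉.IsLinear ψ → 𝔉.base.map φ = 𝔉.base.map ψ →
      𝔉.unitsPull φ = 𝔉.unitsPull ψ)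
    (hproj : ∀ (g h : Aut (𝔉.base.obj 𝔉.BN)) (hh : h ∈ P.pre (𝔉.base.obj 𝔉.BN)),
      ∃ hgh : g * h * g⁻¹ ∈ P.pre (𝔉.base.obj 𝔉.BN),
        𝔉.lDeltaMap g.hom (P.proj _ ⟨h, hh⟩) = P.proj _ ⟨g * h * g⁻¹, hgh⟩)
    (hcup : ∀ (g : Aut (𝔉.base.obj 𝔉.BN)) (h : 𝔉.HB),
      (h : Aut (𝔉.base.obj 𝔉.BN)) ∈ P.pre (𝔉.base.obj 𝔉.BN) →
        ∃ hmem : g * (h : Aut (𝔉.base.obj 𝔉.BN)) * g⁻¹ ∈ 𝔉.HB,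
          𝔉.sgpCup ⟨g * (h : Aut (𝔉.base.obj 𝔉.BN)) * g⁻¹, hmem⟩ =
            𝔉.sgpCap g * 𝔉.sgpCup h * (𝔉.sgpCap g)⁻¹) :
    TransportIndependent 𝔉 ν :=
  transportIndependent_of hUc hLc ν hUb hsec hgal
    (autFunctorial_sgpCap_of_kummerShape_galois hspec hsec P hcov ν (kummerShape_of_thetaPair_galois P hK hη hc)
      hproj hcup)
    (lDeltaModNMap_injective_of_reach hLc hLi hsec hgal hreach)

/-- (v2 record; abc-iut-w4-d008's `cyclotomicRigidity_of_laws` VERBATIM, concluding the v2 statement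
`ThetaSubquotientProjGalois.CyclotomicRigidity`.) **[EtTh] Prop. 5.5 (existence ∧ uniqueness) RE-ASSEMBLED WITHOUT THE P55-L06 INPUT,
on the v2 record**: abc-iut-w6-d079's `cyclotomicRigidity_of_sub_galois` with its hypothesis `hind : TransportIndependent ν` DISCHARGED by
`transportIndependent_of_thetaPair_galois`.  Named inputs: the Prop. 5.2 (iii) pin, P55-L02, P55-L02b, P55-L05, the laws P55-L06b /
T56-L09d, coverage, (G), (S), (U), `hproj`, `hcup`.  [cite: MochizukiEtTh2009, Prop 5.5 p.327–328 (PDF pp.101–102)] -/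
theorem cyclotomicRigidity_of_laws_galois (P : ThetaSubquotientProjGalois 𝔉 Gal) (hB : 𝔉.IsThetaSaturated 𝔉.BN)
    {η : 𝔉.HB → 𝔉.lDeltaModN 𝔉.BN} {ν : 𝔉.lDeltaModN 𝔉.BN ≃* 𝔉.muTorsion 𝔉.BN 𝔉.N}
    (hK : FrobenioidThetaBiKummer.ThetaPairKummerClass 𝔉 η ν) (hη : EtaTautologicalGal 𝔉 P η)
    (hcentral : UnitsCentralUnderLDeltaGal 𝔉 P) (hreach : BijectivelyReachableFromBN 𝔉)
    (hUc : UnitsPullComp 𝔉) (hUi : UnitsPullId 𝔉) (hLc : LDeltaMapComp 𝔉) (hLi : LDeltaMapId 𝔉)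
    (hspec : UnitsPullSpec 𝔉) (hcov : LDeltaCoveredGal 𝔉 P)
    (hgal : ∀ (T : C), 𝔉.IsThetaSaturated T → ∀ (φ φ' : 𝔉.BN ⟶ T), 𝔉.IsLinear φ → 𝔉.IsLinear φ' →
      ∃ g : Aut (𝔉.base.obj 𝔉.BN), 𝔉.base.map φ' = g.hom ≫ 𝔉.base.map φ)
    (hsec : 𝔉.SgpCapSection)
    (hUb : ∀ {S T : C} (φ ψ : S ⟶ T), 𝔉.IsLinear φ → 𝔉.IsLinear ψ → 𝔉.base.map φ = 𝔉.base.map ψ →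
      𝔉.unitsPull φ = 𝔉.unitsPull ψ)
    (hproj : ∀ (g h : Aut (𝔉.base.obj 𝔉.BN)) (hh : h ∈ P.pre (𝔉.base.obj 𝔉.BN)),
      ∃ hgh : g * h * g⁻¹ ∈ P.pre (𝔉.base.obj 𝔉.BN),
        𝔉.lDeltaMap g.hom (P.proj _ ⟨h, hh⟩) = P.proj _ ⟨g * h * g⁻¹, hgh⟩)
    (hcup : ∀ (g : Aut (𝔉.base.obj 𝔉.BN)) (h : 𝔉.HB),
      (h : Aut (𝔉.base.obj 𝔉.BN)) ∈ P.pre (𝔉.base.obj 𝔉.BN) →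
        ∃ hmem : g * (h : Aut (𝔉.base.obj 𝔉.BN)) * g⁻¹ ∈ 𝔉.HB,
          𝔉.sgpCup ⟨g * (h : Aut (𝔉.base.obj 𝔉.BN)) * g⁻¹, hmem⟩ =
            𝔉.sgpCap g * 𝔉.sgpCup h * (𝔉.sgpCap g)⁻¹) :
    P.CyclotomicRigidity hB :=
  cyclotomicRigidity_of_sub_galois P hB hK hη hcentral hreach
    (transportIndependent_of_thetaPair_galois P hK hη (cyclotomeCentral_of_unitsCentral_gal 𝔉 hcentral) hreach hUc hLc hLi
      hspec hcov hgal hsec hUb hproj hcup)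
    hUc hUi hLc hLi hcov

/-! ### The «roofs» route (this lineage's `Sec5Prop55OfRoofs` / `Sec5Prop55RoofIndependentOfLaws`) on the v2 record -/

/-- (v2 record; `cyclotomicRigidity_unique_of_roofs` VERBATIM.) **Prop. 5.5, uniqueness glue from ROOFS**: two Kummer-determined rigidity
families functorial for linear morphisms coincide — they agree at `B_N` (`rigidityFamily_eq_on_BN_of_isKummerDetermined_galois`, coverage
`hcov`) and the roofs transport the agreement (`rigidityFamily_unique_of_roof`).  [cite: MochizukiEtTh2009, Prop 5.5 proof p.328 (PDF p.102)] -/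
theorem cyclotomicRigidity_unique_of_roofs_galois (P : ThetaSubquotientProjGalois 𝔉 Gal) (hB : 𝔉.IsThetaSaturated 𝔉.BN)
    (hroof : ∀ S : C, 𝔉.IsThetaSaturated S → ∃ (R : C) (_ : 𝔉.IsThetaSaturated R) (b : R ⟶ 𝔉.BN) (a : R ⟶ S),
      𝔉.IsLinear b ∧ 𝔉.IsLinear a ∧ Function.Surjective (𝔉.lDeltaModNMap a) ∧ Function.Injective (𝔉.muTorsionPull a 𝔉.N))
    (hcov : ∀ x : 𝔉.lDeltaModN 𝔉.BN, ∃ (h : 𝔉.HB)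
      (hh : (h : Aut (𝔉.base.obj 𝔉.BN)) ∈ P.pre (𝔉.base.obj 𝔉.BN)),
      (QuotientGroup.mk (P.proj _ ⟨h, hh⟩) : 𝔉.lDeltaModN 𝔉.BN) = x)
    (ρ ρ' : RigidityFamily 𝔉) (hK : P.IsKummerDetermined ρ hB) (hF : IsFunctorialLinear 𝔉 ρ)
    (hK' : P.IsKummerDetermined ρ' hB) (hF' : IsFunctorialLinear 𝔉 ρ') : ρ = ρ' :=
  rigidityFamily_unique_of_roof 𝔉 hroof hB hF hF' (𝔉.rigidityFamily_eq_on_BN_of_isKummerDetermined_galois P hB hcov hK hK')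

/-- (v2 record; `cyclotomicRigidity_of_roofs` VERBATIM, concluding the v2 statement.) **[EtTh] Prop. 5.5 DISCHARGED MODULO its existence
half, from ROOFS.**  [cite: MochizukiEtTh2009, Prop 5.5 p.327 (PDF p.101)] -/
theorem cyclotomicRigidity_of_roofs_galois (P : ThetaSubquotientProjGalois 𝔉 Gal) (hB : 𝔉.IsThetaSaturated 𝔉.BN)
    (hroof : ∀ S : C, 𝔉.IsThetaSaturated S → ∃ (R : C) (_ : 𝔉.IsThetaSaturated R) (b : R ⟶ 𝔉.BN) (a : R ⟶ S),
      𝔉.IsLinear b ∧ 𝔉.IsLinear a ∧ Function.Surjective (𝔉.lDeltaModNMap a) ∧ Function.Injective (𝔉.muTorsionPull a 𝔉.N))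
    (hcov : ∀ x : 𝔉.lDeltaModN 𝔉.BN, ∃ (h : 𝔉.HB)
      (hh : (h : Aut (𝔉.base.obj 𝔉.BN)) ∈ P.pre (𝔉.base.obj 𝔉.BN)),
      (QuotientGroup.mk (P.proj _ ⟨h, hh⟩) : 𝔉.lDeltaModN 𝔉.BN) = x)
    (hex : ∃ ρ : RigidityFamily 𝔉, P.IsKummerDetermined ρ hB ∧ IsFunctorialLinear 𝔉 ρ) :
    P.CyclotomicRigidity hB :=
  ⟨hex, cyclotomicRigidity_unique_of_roofs_galois P hB hroof hcov⟩

/-- (v2 record; `cyclotomicRigidity_of_sub_roofs` VERBATIM.) **[EtTh] Prop. 5.5 (existence ∧ uniqueness) MODULO the sub-DAG inputs,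
ROOF FORM, on the v2 record** — twin of abc-iut-w6-d079's `cyclotomicRigidity_of_sub_galois` with P55-L05 (`BijectivelyReachableFromBN`)
and P55-L06 (`TransportIndependent`) replaced by print's two-arrow roof data and their independence; the other inputs (Prop. 5.2 (iii) pin,
`EtaTautologicalGal`, `UnitsCentralUnderLDeltaGal`, P55-L06b laws, coverage) unchanged.  [cite: MochizukiEtTh2009, Prop 5.5 p.327–328 (PDF pp.101–102)] -/
theorem cyclotomicRigidity_of_sub_roofs_galois (P : ThetaSubquotientProjGalois 𝔉 Gal) (hB : 𝔉.IsThetaSaturated 𝔉.BN)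
    {η : 𝔉.HB → 𝔉.lDeltaModN 𝔉.BN} {ν : 𝔉.lDeltaModN 𝔉.BN ≃* 𝔉.muTorsion 𝔉.BN 𝔉.N}
    (hK : FrobenioidThetaBiKummer.ThetaPairKummerClass 𝔉 η ν) (hη : EtaTautologicalGal 𝔉 P η)
    (hcentral : UnitsCentralUnderLDeltaGal 𝔉 P)
    (hroof : ∀ S : C, 𝔉.IsThetaSaturated S → ∃ (R : C) (_ : 𝔉.IsThetaSaturated R) (a : R ⟶ S) (b : R ⟶ 𝔉.BN),
      𝔉.IsLinear a ∧ 𝔉.IsLinear b ∧ Function.Bijective (𝔉.lDeltaModNMap a) ∧ Function.Bijective (𝔉.muTorsionPull a 𝔉.N) ∧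
        Function.Bijective (𝔉.lDeltaModNMap b) ∧ Function.Bijective (𝔉.muTorsionPull b 𝔉.N))
    (hind : ∀ (T : C), 𝔉.IsThetaSaturated T →
      ∀ (R : C), 𝔉.IsThetaSaturated R → ∀ (a : R ⟶ T) (b : R ⟶ 𝔉.BN), 𝔉.IsLinear a → 𝔉.IsLinear b →
      ∀ (R' : C), 𝔉.IsThetaSaturated R' → ∀ (a' : R' ⟶ T) (b' : R' ⟶ 𝔉.BN), 𝔉.IsLinear a' → 𝔉.IsLinear b' →
      ∀ (x : 𝔉.lDeltaModN R) (x' : 𝔉.lDeltaModN R') (u : 𝔉.muTorsion T 𝔉.N),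
        𝔉.lDeltaModNMap a x = 𝔉.lDeltaModNMap a' x' →
        𝔉.muTorsionPull a 𝔉.N u = 𝔉.muTorsionPull b 𝔉.N (ν (𝔉.lDeltaModNMap b x)) →
        𝔉.muTorsionPull a' 𝔉.N u = 𝔉.muTorsionPull b' 𝔉.N (ν (𝔉.lDeltaModNMap b' x')))
    (hUc : UnitsPullComp 𝔉) (hUi : UnitsPullId 𝔉) (hLc : LDeltaMapComp 𝔉) (hLi : LDeltaMapId 𝔉)
    (hcov : LDeltaCoveredGal 𝔉 P) : P.CyclotomicRigidity hB := by
  obtain ⟨ρ, hρB, hρ⟩ := rigidityFamily_exists_of_roofs hB ν hroof hind hUc hUi hLc hLi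
  have hroof' : ∀ S : C, 𝔉.IsThetaSaturated S → ∃ (R : C) (_ : 𝔉.IsThetaSaturated R) (b : R ⟶ 𝔉.BN) (a : R ⟶ S),
      𝔉.IsLinear b ∧ 𝔉.IsLinear a ∧ Function.Surjective (𝔉.lDeltaModNMap a) ∧
        Function.Injective (𝔉.muTorsionPull a 𝔉.N) := fun S hS => by
    obtain ⟨R, hR, a, b, ha, hb, hΔa, hμa, -, -⟩ := hroof S hS
    exact ⟨R, hR, b, a, hb, ha, hΔa.2, hμa.1⟩
  exact cyclotomicRigidity_of_roofs_galois P hB hroof' hcov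
    ⟨ρ, isKummerDetermined_of_thetaPair_gal 𝔉 P hK hη (cyclotomeCentral_of_unitsCentral_gal 𝔉 hcentral) ρ hB hρB, hρ⟩

/-- (v2 record; `cyclotomicRigidity_of_laws_roofs` VERBATIM.) **[EtTh] Prop. 5.5 (existence ∧ uniqueness) FROM ROOFS AND THE LAWS, on the
v2 record** — `cyclotomicRigidity_of_laws_galois` with the fixed-source P55-L05 `BijectivelyReachableFromBN` (a depth constraint,
F-w5d013g5-1) REPLACED by print's roofs `hroof` («linear morphisms `S″ → S`, `S″ → S′` … which induce isomorphisms») and their meeting (M)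
`hmeet`, and the out-transitivity (G) at `B_N ⟶ T` replaced by (G-in) at `R″ ⟶ B_N` («`B_N^bs` is Galois», [SemiAnbd] Def. 3.1 (iv); a
THEOREM over `B^temp(Π)⁰`, `galoisIn_of_isGaloisObj_connectedPart`).  Existence: `rigidityFamily_exists_of_laws_roofs` with (F) from the
Kummer shape of `ν`; Kummer-determined at `B_N` by `isKummerDetermined_of_thetaPair_gal`; uniqueness: `cyclotomicRigidity_of_roofs_galois`.
[cite: MochizukiEtTh2009, Prop 5.5 p.327–328 (PDF pp.101–102)] [cite: MochizukiSemiAnbd2006, Def 3.1(iv) p.33] -/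
theorem cyclotomicRigidity_of_laws_roofs_galois (P : ThetaSubquotientProjGalois 𝔉 Gal) (hB : 𝔉.IsThetaSaturated 𝔉.BN)
    {η : 𝔉.HB → 𝔉.lDeltaModN 𝔉.BN} {ν : 𝔉.lDeltaModN 𝔉.BN ≃* 𝔉.muTorsion 𝔉.BN 𝔉.N}
    (hK : FrobenioidThetaBiKummer.ThetaPairKummerClass 𝔉 η ν) (hη : EtaTautologicalGal 𝔉 P η)
    (hcentral : UnitsCentralUnderLDeltaGal 𝔉 P)
    (hroof : ∀ S : C, 𝔉.IsThetaSaturated S → ∃ (R : C) (_ : 𝔉.IsThetaSaturated R) (a : R ⟶ S) (b : R ⟶ 𝔉.BN),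
      𝔉.IsLinear a ∧ 𝔉.IsLinear b ∧ Function.Bijective (𝔉.lDeltaModNMap a) ∧ Function.Bijective (𝔉.muTorsionPull a 𝔉.N) ∧
        Function.Bijective (𝔉.lDeltaModNMap b) ∧ Function.Bijective (𝔉.muTorsionPull b 𝔉.N))
    (hmeet : ∀ (T : C), 𝔉.IsThetaSaturated T → ∀ (R : C), 𝔉.IsThetaSaturated R → ∀ (a : R ⟶ T), 𝔉.IsLinear a →
      ∀ (R' : C), 𝔉.IsThetaSaturated R' → ∀ (a' : R' ⟶ T), 𝔉.IsLinear a' →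
      ∃ (R'' : C) (_ : 𝔉.IsThetaSaturated R'') (c : R'' ⟶ R) (c' : R'' ⟶ R'),
        𝔉.IsLinear c ∧ 𝔉.IsLinear c' ∧ 𝔉.base.map (c ≫ a) = 𝔉.base.map (c' ≫ a') ∧
          Function.Surjective (𝔉.lDeltaModNMap c') ∧ Function.Injective (𝔉.muTorsionPull c' 𝔉.N))
    (hUc : UnitsPullComp 𝔉) (hUi : UnitsPullId 𝔉) (hLc : LDeltaMapComp 𝔉) (hLi : LDeltaMapId 𝔉)
    (hspec : UnitsPullSpec 𝔉) (hcov : LDeltaCoveredGal 𝔉 P)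
    (hgalIn : ∀ (R : C), 𝔉.IsThetaSaturated R → ∀ (φ φ' : R ⟶ 𝔉.BN), 𝔉.IsLinear φ → 𝔉.IsLinear φ' →
      ∃ g : Aut (𝔉.base.obj 𝔉.BN), 𝔉.base.map φ' = 𝔉.base.map φ ≫ g.hom)
    (hsec : 𝔉.SgpCapSection)
    (hUb : ∀ {S T : C} (φ ψ : S ⟶ T), 𝔉.IsLinear φ → 𝔉.IsLinear ψ → 𝔉.base.map φ = 𝔉.base.map ψ →
      𝔉.unitsPull φ = 𝔉.unitsPull ψ)
    (hproj : ∀ (g h : Aut (𝔉.base.obj 𝔉.BN)) (hh : h ∈ P.pre (𝔉.base.obj 𝔉.BN)),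
      ∃ hgh : g * h * g⁻¹ ∈ P.pre (𝔉.base.obj 𝔉.BN),
        𝔉.lDeltaMap g.hom (P.proj _ ⟨h, hh⟩) = P.proj _ ⟨g * h * g⁻¹, hgh⟩)
    (hcup : ∀ (g : Aut (𝔉.base.obj 𝔉.BN)) (h : 𝔉.HB),
      (h : Aut (𝔉.base.obj 𝔉.BN)) ∈ P.pre (𝔉.base.obj 𝔉.BN) →
        ∃ hmem : g * (h : Aut (𝔉.base.obj 𝔉.BN)) * g⁻¹ ∈ 𝔉.HB,
          𝔉.sgpCup ⟨g * (h : Aut (𝔉.base.obj 𝔉.BN)) * g⁻¹, hmem⟩ =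
            𝔉.sgpCap g * 𝔉.sgpCup h * (𝔉.sgpCap g)⁻¹) :
    P.CyclotomicRigidity hB := by
  have hc : CyclotomeCentralUnderLDeltaGal 𝔉 P := cyclotomeCentral_of_unitsCentral_gal 𝔉 hcentral
  obtain ⟨ρ, hρB, hρ⟩ := rigidityFamily_exists_of_laws_roofs hB ν hroof hmeet hgalIn hsec hUb
    (autFunctorial_sgpCap_of_kummerShape_galois hspec hsec P hcov ν (kummerShape_of_thetaPair_galois P hK hη hc) hproj hcup)
    hUc hUi hLc hLi
  have hroof' : ∀ S : C, 𝔉.IsThetaSaturated S → ∃ (R : C) (_ : 𝔉.IsThetaSaturated R) (b : R ⟶ 𝔉.BN) (a : R ⟶ S),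
      𝔉.IsLinear b ∧ 𝔉.IsLinear a ∧ Function.Surjective (𝔉.lDeltaModNMap a) ∧
        Function.Injective (𝔉.muTorsionPull a 𝔉.N) := fun S hS => by
    obtain ⟨R, hR, a, b, ha, hb, hΔa, hμa, -, -⟩ := hroof S hS
    exact ⟨R, hR, b, a, hb, ha, hΔa.2, hμa.1⟩
  exact cyclotomicRigidity_of_roofs_galois P hB hroof' hcov
    ⟨ρ, isKummerDetermined_of_thetaPair_gal 𝔉 P hK hη hc ρ hB hρB, hρ⟩

/-! ### Thm. 5.6 (i) chain head in roof form (this lineage's `Sec5Thm56OfRoofs`) on the v2 record -/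

section ThmFiveSix

variable (Ψ : C ≌ C) (α : Ψ.functor.obj 𝔉.AN ≅ 𝔉.AN) (β : Ψ.functor.obj 𝔉.BN ≅ 𝔉.BN) (e : 𝔉.AN ≅ 𝔉.AN)
  (Dp : Aut 𝔉.BN) (θ : Aut (𝔉.base.obj 𝔉.BN) ≃* Aut (𝔉.base.obj 𝔉.BN))

/-- (v2 record; `Thm56Sub.cyclotomicRigidityPreserved_of_sub_roofs` VERBATIM.) **EtTh:Thm5.6(i)/T56-A in ROOF form, on the v2 record** —
abc-iut-w6-d079's `cyclotomicRigidityPreserved_of_sub_galois` ([EtTh] Thm. 5.6, both clauses, abc-iut-L2-t4's `P`-free conclusion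
`CyclotomicRigidityPreserved Ψ ρ aΨ`, with the transport at `B_N` DERIVED by `transportAtBN_of_galois`, T56-L09) with the fixed-source
`hreach : LinearlyReachableFromBN` REPLACED by print's roofs `hroof` (T56-L10 via `rigidityFamily_unique_of_roof`) and `hpull` linear-only;
every other binder verbatim, the `P`-typed ones (`hcentral`, `hcompat`, `hK`, `hcov`) read through their v2 twins.
[cite: MochizukiEtTh2009, Thm 5.6 p.328–329 (PDF pp.102–103)] -/
theorem cyclotomicRigidityPreserved_of_sub_roofs_galois [Epi 𝔉.sCap] [Epi 𝔉.sCup]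
    (Ψbs : D ⥤ D) [Ψbs.Faithful] (eΨ : Ψ.functor ⋙ 𝔉.base ≅ 𝔉.base ⋙ Ψbs)
    (aΨ : ∀ S : C, 𝔉.lDeltaModN S ≃* 𝔉.lDeltaModN (Ψ.functor.obj S))
    (ρ : RigidityFamily 𝔉) (hB : 𝔉.IsThetaSaturated 𝔉.BN)
    (hroof : ∀ S : C, 𝔉.IsThetaSaturated S → ∃ (S'' : C) (_ : 𝔉.IsThetaSaturated S'') (φ : S'' ⟶ 𝔉.BN) (ψ : S'' ⟶ S),
      𝔉.IsLinear φ ∧ 𝔉.IsLinear ψ ∧ Function.Surjective (𝔉.lDeltaModNMap ψ) ∧ Function.Injective (𝔉.muTorsionPull ψ 𝔉.N))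
    (hρ : IsFunctorialLinear 𝔉 ρ)
    (hlin : PreFrobenioidData.PreservesMor Ψ.functor 𝔉.IsLinear 𝔉.IsLinear)
    (haΨ : ∀ {S T : C} (φ : S ⟶ T) (x : 𝔉.lDeltaModN S),
      aΨ T (𝔉.lDeltaModNMap φ x) = 𝔉.lDeltaModNMap (Ψ.functor.map φ) (aΨ S x))
    (hpull : ∀ {S T : C} (φ : S ⟶ T), 𝔉.IsLinear φ → ∀ (u : 𝔉.muTorsion T 𝔉.N)
      (hu : Ψ.functor.mapAut T (u : Aut T) ∈ 𝔉.muTorsion (Ψ.functor.obj T) 𝔉.N),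
      Ψ.functor.mapAut S (𝔉.muTorsionPull φ 𝔉.N u : Aut S) =
        (𝔉.muTorsionPull (Ψ.functor.map φ) 𝔉.N ⟨_, hu⟩ : Aut (Ψ.functor.obj S)))
    (hcap : 𝔉.SgpCapSpec) (hcup : 𝔉.SgpCupSpec) (hdiff : 𝔉.BiKummerDifferenceMem)
    (hT : α.inv ≫ Ψ.functor.map 𝔉.sCap ≫ β.hom = e.hom ≫ 𝔉.sCap ≫ (1 : Aut 𝔉.BN).hom)
    (hT' : α.inv ≫ Ψ.functor.map 𝔉.sCup ≫ β.hom = e.hom ≫ 𝔉.sCup ≫ Dp.hom) (hu : Dp ∈ 𝔉.units 𝔉.BN)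
    (hstrv : 𝔉.StrvTransport Ψ α e θ) (hYdd : 𝔉.HB.map θ.toMonoidHom = 𝔉.HB)
    (P : ThetaSubquotientProjGalois 𝔉 Gal) (hcentral : UnitsCentralUnderLDeltaGal 𝔉 P) (hspec : UnitsPullSpec 𝔉)
    (hcompat : DeltaTransportCompatGal 𝔉 Ψ β aΨ θ P) (hK : P.IsKummerDetermined ρ hB)
    (hcov : LDeltaCoveredGal 𝔉 P) :
    CyclotomicRigidityPreserved 𝔉 Ψ ρ aΨ :=
  cyclotomicRigidityPreserved_of_roofs Ψ Ψbs eΨ aΨ ρ hB hroof hρ hlin haΨ hpull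
    (fun hΨB x => transportAtBN_of_galois Ψ α β e Dp θ hcap hcup hdiff hT hT' hu hstrv hYdd P hcentral hspec aΨ
      hcompat ρ hB hK hρ hcov hΨB x)

end ThmFiveSix

end Thm56Sub

end ThetaFrobenioid

end Literature.AnabelianGeometry.EtaleTheta
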